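import Literature.NumberTheory.LFunctions.WeilCriterion
import Literature.NumberTheory.LFunctions.WeilCriterionProofs
import Literature.NumberTheory.LFunctions.WeilSmallSupportPositivity
import Literature.NumberTheory.LFunctions.WeilArchimedeanPositivityHolds
import HarnessLib

/-!
# The wall `UniformWeilPositivity` is the Riemann hypothesis (unconditionally in the tree)

`Literature/NumberTheory/LFunctions/WeilCriterion.lean` states the wall
`rh-w-uniform-weil-positivity` of family `rh` as the named `Prop`
`UniformWeilPositivity = ∀ a > 0, WeilPositivityOn a` (uniform Weil positivity, "`ε(a) ≥ 0` for
all `a > 0`", tagged `[Bombieri2000, §4]`) and proves, CONDITIONALLY on the named fact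
`weil_criterion` (`RHConditionalFacts.lean`), `uniformWeilPositivity_iff (h : weil_criterion) :
UniformWeilPositivity ↔ RiemannHypothesis` and `yoshida_criterion`. Since then Weil's criterion
has been DISCHARGED in the tree (`weil_criterion_holds`, `WeilCriterionProofs.lean`: the explicit
formula `explicit_formula_holds` plus both halves of Bombieri 2000 Thm. 1). This file records the
resulting UNCONDITIONAL theorems, so that the status of the wall is a checkable fact of the tree:

* `uniformWeilPositivity_iff_riemannHypothesis : UniformWeilPositivity ↔ RiemannHypothesis` —
  a term `UniformWeilPositivity_holds` would be a proof of Mathlib's `RiemannHypothesis`. The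
  def is therefore an OPEN CONJECTURE in the sense of D-0014 (CONVENTIONS §4), not a literature
  fact awaiting discharge: its locator `[Bombieri2000, §4]` is where the ground energy `ε(a)` is
  DEFINED (Problems 1–2; Thms. 3–5 prove the infimum is attained, with no sign information), and
  Bombieri, §1: Weil's functional "appears to be as intractable as the Riemann Hypothesis
  itself".
* `riemannHypothesis_iff_forall_weilPositivityOn` — Yoshida's criterion, unconditional form.
* `weilPositivityOn_of_le_log_two_half` — what the sources DO prove towards the wall,
  assembled from the tree's discharged results: Weil positivity on `[-a, a]` for every
  `a ≤ (log 2)/2` (Yoshida 1992 Thm. 1, `weilPositivityOn_log_two_half_holds`,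
  `WeilArchimedeanPositivityHolds.lean`; Bombieri 2000 §12 Thm. 12 gives all sufficiently
  small `a` with coercivity, `Bombieri2000Thm12_holds`, `exists_weilPositivityOn_small`,
  `WeilSmallSupportPositivity.lean`). The complementary range `a > (log 2)/2` of the wall is
  exactly as hard as RH.

Nothing here is new mathematics; no definitions, no named facts.

## References

* E. Bombieri, *Remarks on Weil's quadratic functional in the theory of prime numbers I*, Atti
  Accad. Naz. Lincei Rend. Lincei (9) Mat. Appl. 11 (2000), 183–233: §1; §3 Thms. 1–2; §4
  Problems 1–2, Thms. 3–5; §12 Thm. 12 (Zbl 1008.11034; held copy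
  `paper:galaxy-pdf-4005501466549090220`).
* H. Yoshida, *On Hermitian forms attached to zeta functions*, Adv. Stud. Pure Math. 21 (1992),
  281–325, Thm. 1.
-/

noncomputable section

namespace Literature.NumberTheory.LFunctions

/-- **The wall is RH, unconditionally**: `UniformWeilPositivity ↔ RiemannHypothesis`
(`uniformWeilPositivity_iff` of `WeilCriterion.lean` fed with the discharged Weil criterion
`weil_criterion_holds`; E. Bombieri, Rend. Lincei (9) 11 (2000), Thm. 2, with Yoshida's
fixed-support reformulation of §§3–4). Consequently `UniformWeilPositivity` cannot be discharged
short of proving the Riemann hypothesis. [cite: Bombieri2000Weil, Thm. 2] -/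
theorem uniformWeilPositivity_iff_riemannHypothesis :
    UniformWeilPositivity ↔ RiemannHypothesis :=
  uniformWeilPositivity_iff weil_criterion_holds

/-- **Yoshida's criterion, unconditional form**: the Riemann hypothesis holds iff Weil
positivity holds on every truncated cone `K_a`, `a > 0` (`yoshida_criterion` of
`WeilCriterion.lean` with `weil_criterion_holds`; Yoshida 1992; Bombieri 2000 Thm. 2 and §4).
[cite: Bombieri2000Weil, Thm. 2] -/
theorem riemannHypothesis_iff_forall_weilPositivityOn :
    RiemannHypothesis ↔ ∀ a : ℝ, 0 < a → WeilPositivityOn a :=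
  yoshida_criterion weil_criterion_holds

/-- **The printed part of the wall holds**: Weil positivity on `[-a, a]` for every
`a ≤ (log 2)/2` — Yoshida 1992 Thm. 1 as discharged in the tree
(`weilPositivityOn_log_two_half_holds`) and antitonicity of `WeilPositivityOn` in `a`
(`WeilPositivityOn.mono`: a test function supported in `[-a, a]` is supported in
`[-(log 2)/2, (log 2)/2]`). Bombieri 2000 Thm. 12 (`Bombieri2000Thm12_holds`) gives the
same for all sufficiently small `a` (`exists_weilPositivityOn_small`); the range `(log 2)/2` is
Yoshida's (Adv. Stud. Pure Math. 21 (1992), Thm. 1, p. 310; reported in Bombieri 2000 §1).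
[cite: Yoshida1992, Thm. 1 (p. 310)] -/
theorem weilPositivityOn_of_le_log_two_half {a : ℝ} (hle : a ≤ Real.log 2 / 2) :
    WeilPositivityOn a :=
  WeilPositivityOn.mono hle weilPositivityOn_log_two_half_holds

end Literature.NumberTheory.LFunctions

end
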